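import Literature.NumberTheory.Transcendental.FormIntegrationCharts
import HarnessLib

/-!
# Additivity of the integral of top-degree forms (`MForm.integral_add` discharged)

Topic: integration of differential forms on compact oriented manifolds. This file discharges
the named fact `Literature.Geometry.Kaehler.MForm.integral_add` of
`Literature/NumberTheory/Transcendental/FormIntegration.lean`:
on a compact manifold `M` (boundary and corners allowed) with a continuous orientation family
`o`, `∫_M (α + β) = ∫_M α + ∫_M β` for smooth top forms `α`, `β`
(Lee (2013), Prop. 16.6(a), linearity of `∫_M`, left there as Exercise 16.7;
Warner (1983), 4.8). Everything is proved; no `Boundaryless` hypothesis is used (all the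
analysis happens on the chart targets, within `range I`).

## Main statements (all proved)

* `Literature.NumberTheory.Transcendental.IsContinuousOrientation.continuousOn_chartSign`: for a
  continuous orientation family the chart sign `chartSign o p` is continuous (locally constant)
  on the *whole* chart target `(extChartAt I p).target`, not only near the centre (transition
  formula `chartSign_extChartAt_eq_sign_det_mul`, continuity and non-vanishing of the Jacobian
  determinant of the tangent coordinate change).
* `Literature.Geometry.Kaehler.IsSmoothForm.continuousOn_inChart_apply_modelBasis`: the
  coefficient `y ↦ α̂_p(y)(e₁, …, eₙ)` of the chart representative of a smooth top form is
  continuous on the whole chart target (transition formula `MForm.inChart_extChartAt_eq_comp`).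
* `Literature.NumberTheory.Transcendental.integrableOn_chartIntegrand`: the chart integrands in
  the definition of `MForm.integral` are integrable on the chart targets (continuous there, and
  vanishing off the compact image of `tsupport (ρ i)`).
* `Literature.NumberTheory.Transcendental.hasFiniteSupport_chartIntegral`: only finitely many
  chart integrals are nonzero on a compact manifold.
* `Literature.Geometry.Kaehler.MForm.integral_add_holds : MForm.integral_add o`.

## Proof architecture

`∫_M α = ∑ᶠ i, ∫_{(extChartAt I i).target} chartSign o i · (ρ i ∘ chart⁻¹) · α̂_i(e) dλ`
(`MForm.integral`, `MForm.integralPU`). The chart representative is additive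
(`MForm.inChart_add`), so additivity of `∫_M` reduces to `MeasureTheory.integral_add` chart by
chart (integrability: `integrableOn_chartIntegrand`) and `finsum_add_distrib` (finiteness:
`hasFiniteSupport_chartIntegral`). Lee leaves the statement as an exercise; the only
mathematical content is the continuity of the integrands on the chart targets, which is where
the orientation hypothesis `IsContinuousOrientation o` and the smoothness of the forms enter.

## References

* J. M. Lee, *Introduction to Smooth Manifolds*, 2nd ed., GTM 218, Springer (2013),
  Prop. 16.6(a) and Exercise 16.7 (PDF p. 440), Prop. 15.6 (PDF p. 415).
* F. W. Warner, *Foundations of Differentiable Manifolds and Lie Groups*, GTM 94, Springer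
  (1983), 4.8 (integration on oriented manifolds; linearity of `∫_M`).
-/

noncomputable section

open scoped Manifold ContDiff Topology
open Bundle Set Module MeasureTheory Function Filter

namespace Literature.NumberTheory.Transcendental

/-! ### Transport of continuity between `M` and chart targets -/

section Transport

variable {E : Type*} [NormedAddCommGroup E] [NormedSpace ℝ E]
  {H : Type*} [TopologicalSpace H] {I : ModelWithCorners ℝ E H}
  {M : Type*} [TopologicalSpace M] [ChartedSpace H M]

/-- The extended chart at `x`, as a map `M → E`, tends at `x` to its centre *within `range I`*
(it is continuous at `x` and takes values in `range I`). [folklore] -/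
theorem tendsto_extChartAt_nhdsWithin_range (x : M) :
    Tendsto (extChartAt I x) (𝓝 x) (𝓝[range I] (extChartAt I x x)) :=
  tendsto_nhdsWithin_iff.2 ⟨continuousAt_extChartAt x,
    Eventually.of_forall fun z ↦ by rw [extChartAt_coe]; exact mem_range_self _⟩

/-- Transport of continuity from `M` to a chart target: if `z ↦ f (extChartAt I p z)` is
continuous at `(extChartAt I p).symm y` for a point `y` of the chart target, then `f` is
continuous within the chart target at `y` (compose with the continuous inverse chart).
[folklore] -/
theorem continuousWithinAt_target_of_continuousAt_comp {X : Type*} [TopologicalSpace X]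
    {f : E → X} {p : M} {y : E} (hy : y ∈ (extChartAt I p).target)
    (h : ContinuousAt (fun z ↦ f (extChartAt I p z)) ((extChartAt I p).symm y)) :
    ContinuousWithinAt f (extChartAt I p).target y := by
  refine (h.comp_continuousWithinAt (continuousOn_extChartAt_symm p y hy)).congr
    (fun y' hy' ↦ ?_) ?_
  · simp only [Function.comp_apply, (extChartAt I p).right_inv hy']
  · simp only [Function.comp_apply, (extChartAt I p).right_inv hy]

/-- Chart targets are Borel measurable: `(extChartAt I p).target` is the intersection of an open
set with the closed set `range I`. [folklore] -/
theorem measurableSet_extChartAt_target [MeasurableSpace E] [OpensMeasurableSpace E] (p : M) :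
    MeasurableSet (extChartAt I p).target := by
  rw [extChartAt_target]
  exact ((chartAt H p).open_target.preimage I.continuous_symm).measurableSet.inter
    I.isClosed_range.measurableSet

end Transport

/-! ### The Jacobian determinant of the tangent coordinate change -/

section Det

variable {E : Type*} [NormedAddCommGroup E] [NormedSpace ℝ E]
  {H : Type*} [TopologicalSpace H] {I : ModelWithCorners ℝ E H}
  {M : Type*} [TopologicalSpace M] [ChartedSpace H M] [IsManifold I ∞ M]

/-- The tangent coordinate change between the charts at `p` and `q` has nonzero determinant at
every point of the overlap (its inverse is the coordinate change from `q` to `p`, by the cocycle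
property `tangentCoordChange_comp`). A namesake with the hypothesis bundled as a membership
in the intersection lives in `Literature.Topology.FourManifolds` (`SmoothOrientationProofs`),
not imported here to keep the import graph of the integration files light. [folklore] -/
theorem det_tangentCoordChange_ne_zero {p q x : M} (hp : x ∈ (extChartAt I p).source)
    (hq : x ∈ (extChartAt I q).source) :
    LinearMap.det (tangentCoordChange I p q x : E →ₗ[ℝ] E) ≠ 0 := by
  have hcomp : (tangentCoordChange I q p x : E →ₗ[ℝ] E).comp
      (tangentCoordChange I p q x : E →ₗ[ℝ] E) = LinearMap.id := by
    apply LinearMap.ext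
    intro v
    simp only [ContinuousLinearMap.coe_coe, LinearMap.coe_comp, Function.comp_apply,
      LinearMap.id_coe, id_eq]
    rw [tangentCoordChange_comp ⟨⟨hp, hq⟩, hp⟩]
    exact tangentCoordChange_self hp
  have hdet : LinearMap.det (tangentCoordChange I q p x : E →ₗ[ℝ] E) *
      LinearMap.det (tangentCoordChange I p q x : E →ₗ[ℝ] E) = 1 := by
    rw [← LinearMap.det_comp, hcomp, LinearMap.det_id]
  intro h
  rw [h, mul_zero] at hdet
  exact zero_ne_one hdet

/-- The sign of the Jacobian determinant of the tangent coordinate change is locally constant on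
the overlap of the two chart sources (the determinant is continuous and nonvanishing there).
[folklore] -/
theorem eventually_sign_det_tangentCoordChange {p q x : M} (hp : x ∈ (extChartAt I p).source)
    (hq : x ∈ (extChartAt I q).source) :
    ∀ᶠ z in 𝓝 x, Real.sign (LinearMap.det (tangentCoordChange I p q z : E →ₗ[ℝ] E)) =
      Real.sign (LinearMap.det (tangentCoordChange I p q x : E →ₗ[ℝ] E)) := by
  have hcont : ContinuousAt
      (fun z ↦ LinearMap.det (tangentCoordChange I p q z : E →ₗ[ℝ] E)) x := by
    have h1 : ContinuousAt (tangentCoordChange I p q) x :=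
      (continuousOn_tangentCoordChange p q).continuousAt
        (((isOpen_extChartAt_source p).inter (isOpen_extChartAt_source q)).mem_nhds ⟨hp, hq⟩)
    exact ContinuousLinearMap.continuous_det.continuousAt.comp h1
  rcases lt_trichotomy (LinearMap.det (tangentCoordChange I p q x : E →ₗ[ℝ] E)) 0 with h | h | h
  · filter_upwards [hcont.tendsto.eventually (gt_mem_nhds h)] with z hz
    rw [Real.sign_of_neg hz, Real.sign_of_neg h]
  · exact absurd h (det_tangentCoordChange_ne_zero hp hq)
  · filter_upwards [hcont.tendsto.eventually (lt_mem_nhds h)] with z hz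
    rw [Real.sign_of_pos hz, Real.sign_of_pos h]

end Det

/-! ### Continuity of chart signs and of chart representatives on the whole chart target -/

section ChartContinuity

variable {E : Type*} [NormedAddCommGroup E] [NormedSpace ℝ E] [FiniteDimensional ℝ E]
  {n : ℕ} [Fact (finrank ℝ E = n)]
  {H : Type*} [TopologicalSpace H] {I : ModelWithCorners ℝ E H}
  {M : Type*} [TopologicalSpace M] [ChartedSpace H M] [IsManifold I ∞ M]
  {o : (x : M) → Orientation ℝ (TangentSpace I x) (Fin n)}

/-- For a continuous orientation family, the chart sign of the chart at `p`, read through the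
chart (`z ↦ chartSign o p (extChartAt I p z)`), is locally constant on the chart source: near
`x` it factors as the (locally constant) sign of the Jacobian determinant of the coordinate
change to the chart at `x`, times the chart sign of the chart at `x`, which is locally constant
near its own centre by hypothesis. Lee (2013), Prop. 15.6. [cite: LeeSmoothManifolds2013, Prop. 15.6] -/
theorem IsContinuousOrientation.eventually_chartSign_extChartAt_eq
    (ho : IsContinuousOrientation o) {p x : M} (hx : x ∈ (extChartAt I p).source) :
    ∀ᶠ z in 𝓝 x, chartSign o p (extChartAt I p z) = chartSign o p (extChartAt I p x) := by
  have h1 : ∀ᶠ z in 𝓝 x,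
      chartSign o x (extChartAt I x z) = chartSign o x (extChartAt I x x) :=
    ((tendsto_extChartAt_nhdsWithin_range x).eventually (ho x)).mono fun z hz ↦ hz.1
  have h2 := eventually_sign_det_tangentCoordChange (I := I) hx (mem_extChartAt_source x)
  have h3 : ∀ᶠ z in 𝓝 x, z ∈ (extChartAt I p).source ∩ (extChartAt I x).source :=
    ((isOpen_extChartAt_source p).inter (isOpen_extChartAt_source x)).mem_nhds
      ⟨hx, mem_extChartAt_source x⟩
  filter_upwards [h1, h2, h3] with z hz1 hz2 hz3
  rw [chartSign_extChartAt_eq_sign_det_mul o hz3.1 hz3.2,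
    chartSign_extChartAt_eq_sign_det_mul o hx (mem_extChartAt_source x), hz1, hz2]

/-- **Chart signs of a continuous orientation family are continuous (locally constant) on the
whole chart target.** Lee (2013), Prop. 15.6 (a continuous pointwise orientation is constant
`±1` on the coordinate frames near every point of a chart). [cite: LeeSmoothManifolds2013, Prop. 15.6] -/
theorem IsContinuousOrientation.continuousOn_chartSign (ho : IsContinuousOrientation o) (p : M) :
    ContinuousOn (chartSign o p) (extChartAt I p).target := fun _ hy ↦
  continuousWithinAt_target_of_continuousAt_comp hy
    (continuousAt_const.congr_of_eventuallyEq
      (ho.eventually_chartSign_extChartAt_eq ((extChartAt I p).map_target hy)))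

/-- **The coefficient of the chart representative of a smooth top form on the reference frame is
continuous on the whole chart target** (not only at the centre): near the chart point of `x` it
is `det (tangentCoordChange I p x ·)` times the coefficient in the chart at `x`, read through
the chart at `x` (transition formula, Lee (2013), Lemma 14.16; Warner (1983), 2.18).
[cite: LeeSmoothManifolds2013, Lemma 14.16] -/
theorem _root_.Literature.Geometry.Kaehler.IsSmoothForm.continuousOn_inChart_apply_modelBasis
    {α : Literature.Geometry.Kaehler.MForm I M ℝ n} (hα : Literature.Geometry.Kaehler.IsSmoothForm α)
    (p : M) :
    ContinuousOn (fun y ↦ α.inChart p y (modelBasis E n)) (extChartAt I p).target := by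
  intro y hy
  refine continuousWithinAt_target_of_continuousAt_comp hy ?_
  set x := (extChartAt I p).symm y with hxdef
  have hx : x ∈ (extChartAt I p).source := (extChartAt I p).map_target hy
  have hO : (extChartAt I p).source ∩ (extChartAt I x).source ∈ 𝓝 x :=
    ((isOpen_extChartAt_source p).inter (isOpen_extChartAt_source x)).mem_nhds
      ⟨hx, mem_extChartAt_source x⟩
  have heq : (fun z ↦ α.inChart p (extChartAt I p z) (modelBasis E n)) =ᶠ[𝓝 x] fun z ↦
      LinearMap.det (tangentCoordChange I p x z : E →ₗ[ℝ] E) *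
        α.inChart x (extChartAt I x z) (modelBasis E n) := by
    filter_upwards [hO] with z hz
    rw [Literature.Geometry.Kaehler.MForm.inChart_extChartAt_eq_comp α hz.1 hz.2,
      ContinuousAlternatingMap.compContinuousLinearMap_apply]
    exact ContinuousAlternatingMap.apply_comp_eq_det_mul (modelBasis E n) _ _ _
  refine ContinuousAt.congr_of_eventuallyEq ?_ heq
  have h1 : ContinuousAt (fun z ↦ LinearMap.det (tangentCoordChange I p x z : E →ₗ[ℝ] E)) x :=
    ContinuousLinearMap.continuous_det.continuousAt.comp
      ((continuousOn_tangentCoordChange p x).continuousAt hO)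
  have h2 : ContinuousAt (fun z ↦ α.inChart x (extChartAt I x z) (modelBasis E n)) x :=
    ((hα x).continuousWithinAt.tendsto.comp (tendsto_extChartAt_nhdsWithin_range x)).eval_const
      (modelBasis E n : Fin n → E)
  exact h1.mul h2

/-! ### Integrability of the chart integrands and finiteness of the sum -/

variable [MeasurableSpace E] [BorelSpace E] [T2Space M] [SigmaCompactSpace M] [CompactSpace M]

/-- **The chart integrands of `∫_M α` are integrable.** For a continuous orientation family and a
smooth top form on a compact manifold, the integrand
`chartSign o i · (ρ i ∘ chart⁻¹) · α̂_i(e₁, …, eₙ)` of the `i`-th chart integral in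
`MForm.integral` is integrable on the chart target: it is continuous there and vanishes off the
compact set `extChartAt I i '' tsupport (ρ i)`. Lee (2013), Prop. 16.5 / eq. (16.2) (each term
of the defining sum is a well-defined integral). [cite: LeeSmoothManifolds2013, Prop. 16.5] -/
theorem integrableOn_chartIntegrand (ho : IsContinuousOrientation o)
    {α : Literature.Geometry.Kaehler.MForm I M ℝ n} (hα : Literature.Geometry.Kaehler.IsSmoothForm α)
    (i : M) :
    IntegrableOn (fun y ↦ chartSign o i y * chartPartitionOfUnity I M i ((extChartAt I i).symm y) *
        α.inChart i y (modelBasis E n)) (extChartAt I i).target (modelBasis E n).addHaar := by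
  have hsub : tsupport (chartPartitionOfUnity I M i) ⊆ (extChartAt I i).source := by
    rw [extChartAt_source]
    exact chartPartitionOfUnity_isSubordinate i
  set K := extChartAt I i '' tsupport (chartPartitionOfUnity I M i) with hK
  have hKc : IsCompact K :=
    (isClosed_tsupport _).isCompact.image_of_continuousOn ((continuousOn_extChartAt i).mono hsub)
  have hKt : K ⊆ (extChartAt I i).target := by
    rintro _ ⟨x, hx, rfl⟩
    exact (extChartAt I i).map_source (hsub hx)
  have hcont : ContinuousOn (fun y ↦ chartSign o i y *
      chartPartitionOfUnity I M i ((extChartAt I i).symm y) * α.inChart i y (modelBasis E n))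
      (extChartAt I i).target :=
    ((ho.continuousOn_chartSign i).mul
      ((map_continuous (chartPartitionOfUnity I M i)).comp_continuousOn
        (continuousOn_extChartAt_symm i))).mul
      (hα.continuousOn_inChart_apply_modelBasis i)
  refine ((hcont.mono hKt).integrableOn_compact hKc).of_forall_sdiff_eq_zero
    (measurableSet_extChartAt_target i) fun y hy ↦ ?_
  have h0 : chartPartitionOfUnity I M i ((extChartAt I i).symm y) = 0 := by
    by_contra h
    exact hy.2 ⟨(extChartAt I i).symm y, subset_tsupport _ h, (extChartAt I i).right_inv hy.1⟩
  rw [h0, mul_zero, zero_mul]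

variable (o) in
/-- **Only finitely many chart integrals are nonzero** on a compact manifold: the partition of
unity is locally finite, so all but finitely many `ρ i` vanish identically, and with them the
corresponding chart integrands. Lee (2013), eq. (16.2) (a finite sum). [cite: LeeSmoothManifolds2013, Prop. 16.5] -/
theorem hasFiniteSupport_chartIntegral (α : Literature.Geometry.Kaehler.MForm I M ℝ n) :
    HasFiniteSupport fun i ↦ ∫ y in (extChartAt I i).target,
      chartSign o i y * chartPartitionOfUnity I M i ((extChartAt I i).symm y) *
        α.inChart i y (modelBasis E n) ∂(modelBasis E n).addHaar := by
  refine ((chartPartitionOfUnity I M).locallyFinite.finite_nonempty_of_compact).subset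
    fun i hi ↦ ?_
  by_contra h
  apply hi
  have h0 : ∀ x, chartPartitionOfUnity I M i x = 0 := fun x ↦ by_contra fun hx ↦ h ⟨x, hx⟩
  simp only [h0, mul_zero, zero_mul, integral_zero]

/-! ### Additivity of `∫_M` -/

omit [CompactSpace M] in
variable (o) in
/-- **Additivity of the integral of smooth top forms on a compact oriented manifold**,
`∫_M (α + β) = ∫_M α + ∫_M β`: discharge of the named fact `MForm.integral_add`
(Lee (2013), Prop. 16.6(a) / Exercise 16.7; Warner (1983), 4.8). Chart by chart by
`MeasureTheory.integral_add` (integrability: `integrableOn_chartIntegrand`), then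
`finsum_add_distrib` (finiteness: `hasFiniteSupport_chartIntegral`).
[cite: LeeSmoothManifolds2013, Prop. 16.6] -/
theorem _root_.Literature.Geometry.Kaehler.MForm.integral_add_holds :
    Literature.Geometry.Kaehler.MForm.integral_add o := by
  intro _ ho α β hα hβ
  have key : ∀ i : M,
      (∫ y in (extChartAt I i).target, chartSign o i y *
          chartPartitionOfUnity I M i ((extChartAt I i).symm y) *
            (α + β).inChart i y (modelBasis E n) ∂(modelBasis E n).addHaar) =
        (∫ y in (extChartAt I i).target, chartSign o i y *
          chartPartitionOfUnity I M i ((extChartAt I i).symm y) *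
            α.inChart i y (modelBasis E n) ∂(modelBasis E n).addHaar) +
        ∫ y in (extChartAt I i).target, chartSign o i y *
          chartPartitionOfUnity I M i ((extChartAt I i).symm y) *
            β.inChart i y (modelBasis E n) ∂(modelBasis E n).addHaar := fun i ↦ by
    rw [← integral_add (integrableOn_chartIntegrand ho hα i) (integrableOn_chartIntegrand ho hβ i)]
    refine integral_congr_ae (Eventually.of_forall fun y ↦ ?_)
    simp only [Literature.Geometry.Kaehler.MForm.inChart_add, Pi.add_apply,
      ContinuousAlternatingMap.add_apply]
    ring
  calc (α + β).integral o
      = ∑ᶠ i : M, ((∫ y in (extChartAt I i).target, chartSign o i y *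
          chartPartitionOfUnity I M i ((extChartAt I i).symm y) *
            α.inChart i y (modelBasis E n) ∂(modelBasis E n).addHaar) +
        ∫ y in (extChartAt I i).target, chartSign o i y *
          chartPartitionOfUnity I M i ((extChartAt I i).symm y) *
            β.inChart i y (modelBasis E n) ∂(modelBasis E n).addHaar) := finsum_congr key
    _ = α.integral o + β.integral o :=
        finsum_add_distrib (hasFiniteSupport_chartIntegral o α) (hasFiniteSupport_chartIntegral o β)

end ChartContinuity

end Literature.NumberTheory.Transcendental
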